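import Mathlib
import Literature.NumberTheory.LFunctions.FeketePolynomial
import Literature.RingTheory.Valuation.AlgClosedResidue

/-!
# `FeketeSOS.FeketeBoundedFanin` (stmt-ValiantsHypothesis-3998), line `witt-pascal-ufa` — stub `stub_placeReduction`

Reduction data at a PLACE OF `ℂ` ABOVE `p` for a complex weighted sum-of-squares representation
`Σ_{i<s} c_i g_i² = F_p` of the Fekete polynomial.  Take a valuation subring `V ⊂ ℂ` with `p ∈ 𝔪_V`
(`Literature.RingTheory.Valuation.exists_valuationSubring_natCast_mem_maximalIdeal`, Chevalley).  Let
`U = ⋃ supp g_i` and view each `g_i` as its coefficient row `γ_i : U → ℂ`; pick a basis of the row space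
`W = span_ℂ(γ_i)` (dimension `r ≤ s`), i.e. an `r × U` matrix `M` with independent rows, and among all
`r × r` minors of `M` one, on columns `σ`, of LARGEST valuation (it is non-zero since some minor is, row
rank = column rank).  With `P = M|_σ` the re-based rows `N = P⁻¹ M` have every entry a ratio of two minors
(Cramer), hence in `V`, and `N|_σ = 1`; so the polynomials `w_j = Σ_u N_{ju} X^u ∈ V[X]` have supports in
`U`, their reductions are linearly independent (the identity block survives), and `g_i = Σ_j A_{ij} w_j`
over `ℂ`.  Expanding, `Σ_{j,j'} T₀_{jj'} w_j w_{j'} = F_p` with the Gram matrix `T₀ = Aᵀ diag(c) A ∈ M_r(ℂ)`.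
Normalise: if `T₀` is `V`-integral take `T = T₀`, `μ = 1`; otherwise divide by the entry `t` of `T₀` of
largest valuation (`t ∉ V`, so `t⁻¹ ∈ 𝔪_V ∖ {0}`): `T = t⁻¹ T₀ ∈ M_r(V)` has an entry `1` and `μ = t⁻¹`.  The
identity `Σ T_{jj'} w_j w_{j'} = μ F_p` then holds in `V[X]` because `V[X] → ℂ[X]` is injective.
-/

namespace Summit.ValiantsHypothesis.ValiantsHypothesis.Theorems.FeketeBoundedFaninWPU

open Polynomial IsLocalRing
open Literature.NumberTheory.LFunctions
open Literature.RingTheory.Valuation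

-- `Summit.ValiantsHypothesis.ValiantsHypothesis.…` is the tree's mandated single-conjunct layout (Sub = Summit).
set_option linter.dupNamespace false

/-! ### Small helpers: polynomials supported on a finite set of exponents -/

/-- Coefficients of the polynomial `Σ_{u ∈ U} v_u X^u` attached to a coefficient vector `v : U → R`. -/
theorem pr2_coeff_sum_C_mul_X_pow {R : Type*} [CommSemiring R] (U : Finset ℕ) (v : U → R) (m : ℕ) :
    (∑ u : U, C (v u) * X ^ (u : ℕ)).coeff m = if h : m ∈ U then v ⟨m, h⟩ else 0 := by
  classical
  rw [finsetSum_coeff]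
  simp_rw [coeff_C_mul_X_pow]
  split_ifs with h
  · rw [Finset.sum_eq_single ⟨m, h⟩]
    · rw [if_pos rfl]
    · intro u _ hu
      rw [if_neg]
      intro hmu
      apply hu
      exact Subtype.ext hmu.symm
    · intro h'
      exact absurd (Finset.mem_univ _) h'
  · refine Finset.sum_eq_zero fun u _ => ?_
    rw [if_neg]
    intro hmu
    apply h
    rw [hmu]
    exact u.2

/-- The coefficient of `Σ_{u ∈ U} v_u X^u` at an exponent `u ∈ U` is `v_u`. -/
theorem pr2_coeff_sum_coe {R : Type*} [CommSemiring R] (U : Finset ℕ) (v : U → R) (u : U) :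
    (∑ u : U, C (v u) * X ^ (u : ℕ)).coeff (u : ℕ) = v u := by
  rw [pr2_coeff_sum_C_mul_X_pow, dif_pos u.2]

/-- `Σ_{u ∈ U} v_u X^u` is supported on `U`. -/
theorem pr2_support_sum_subset {R : Type*} [CommSemiring R] (U : Finset ℕ) (v : U → R) :
    (∑ u : U, C (v u) * X ^ (u : ℕ)).support ⊆ U := by
  intro m hm
  rw [mem_support_iff, pr2_coeff_sum_C_mul_X_pow] at hm
  by_contra h
  rw [dif_neg h] at hm
  exact hm rfl

/-- `Σ_{u ∈ U} v_u X^u` commutes with ring maps applied coefficientwise. -/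
theorem pr2_map_sum {R S : Type*} [CommSemiring R] [CommSemiring S] (f : R →+* S) (U : Finset ℕ)
    (v : U → R) :
    (∑ u : U, C (v u) * X ^ (u : ℕ)).map f = ∑ u : U, C (f (v u)) * X ^ (u : ℕ) := by
  simp only [Polynomial.map_sum, Polynomial.map_mul, Polynomial.map_pow, map_C, map_X]

/-- A polynomial supported on `U` is `Σ_{u ∈ U} f_u X^u`. -/
theorem pr2_eq_sum_of_support_subset {R : Type*} [CommSemiring R] (U : Finset ℕ) {f : R[X]}
    (hf : f.support ⊆ U) :
    f = ∑ u : U, C (f.coeff u) * X ^ (u : ℕ) := by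
  ext m
  rw [pr2_coeff_sum_C_mul_X_pow]
  split_ifs with h
  · rfl
  · exact notMem_support_iff.mp fun hm => h (hf hm)

/-- Linearity of `v ↦ Σ_{u ∈ U} v_u X^u`. -/
theorem pr2_sum_smul_emb {R : Type*} [CommSemiring R] (U : Finset ℕ) {ι : Type*} [Fintype ι]
    (a : ι → R) (v : ι → U → R) :
    (∑ u : U, C ((∑ j, a j • v j) u) * X ^ (u : ℕ)) =
      ∑ j, C (a j) * ∑ u : U, C (v j u) * X ^ (u : ℕ) := by
  simp only [Finset.sum_apply, Pi.smul_apply, smul_eq_mul, map_sum, map_mul, Finset.sum_mul,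
    Finset.mul_sum]
  rw [Finset.sum_comm]
  exact Finset.sum_congr rfl fun j _ => Finset.sum_congr rfl fun u _ => by ring

/-- Linearly independent coefficient vectors give linearly independent polynomials. -/
theorem pr2_linearIndependent_emb {R : Type*} [CommRing R] (U : Finset ℕ) {ι : Type*} [Fintype ι]
    {v : ι → U → R} (hv : LinearIndependent R v) :
    LinearIndependent R (fun j => ∑ u : U, C (v j u) * X ^ (u : ℕ)) := by
  rw [Fintype.linearIndependent_iff] at hv ⊢
  intro a ha j
  refine hv a ?_ j
  funext u
  have h := congrArg (fun P : R[X] => P.coeff (u : ℕ)) ha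
  rw [finsetSum_coeff, coeff_zero] at h
  simp_rw [coeff_smul, pr2_coeff_sum_coe, smul_eq_mul] at h
  simp only [Finset.sum_apply, Pi.smul_apply, Pi.zero_apply, smul_eq_mul]
  exact h

/-- Rows of a matrix containing an identity block (on the columns `σ`) are linearly independent. -/
theorem pr2_linearIndependent_of_submatrix_one {K : Type*} [CommRing K] {ι κ : Type*} [Fintype ι]
    [DecidableEq ι] {R : ι → κ → K} (σ : ι → κ) (h : ∀ j k, R j (σ k) = if j = k then 1 else 0) :
    LinearIndependent K R := by
  rw [Fintype.linearIndependent_iff]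
  intro a ha k
  have h1 := congrFun ha (σ k)
  simp only [Finset.sum_apply, Pi.smul_apply, smul_eq_mul, h, mul_ite, mul_one, mul_zero,
    Finset.sum_ite_eq', Finset.mem_univ, if_true, Pi.zero_apply] at h1
  exact h1

/-- If the `c` rows of a `c × n` matrix over a field are linearly independent, some `c × c` minor is
non-zero (row rank = column rank).  (Adapted from
`Literature.AlgebraicGeometry.Smoothening.exists_submatrix_det_ne_zero_of_linearIndependent`, to avoid the
algebraic-geometry imports of that file.) -/
theorem pr2_exists_submatrix_det_ne_zero {L : Type*} [Field L] {c : ℕ} {n : Type*} [Fintype n]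
    [DecidableEq n] (M : Matrix (Fin c) n L) (hM : LinearIndependent L M.row) :
    ∃ a : Fin c → n, (M.submatrix id a).det ≠ 0 := by
  classical
  have hrank : M.rank = c := by rw [hM.rank_matrix, Fintype.card_fin]
  have hcols : Submodule.span L (Set.range M.col) = ⊤ := by
    apply Submodule.eq_top_of_finrank_eq
    rw [← Matrix.rank_eq_finrank_span_cols, hrank, Module.finrank_fintype_fun_eq_card,
      Fintype.card_fin]
  obtain ⟨κ, a, ha, hspan, hli⟩ := exists_linearIndependent' L M.col
  haveI : Finite κ := Finite.of_injective a ha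
  letI : Fintype κ := Fintype.ofFinite κ
  have hcard : Fintype.card κ = c := by
    have h := finrank_span_eq_card hli
    rw [hspan, hcols, finrank_top, Module.finrank_fintype_fun_eq_card, Fintype.card_fin] at h
    exact h.symm
  obtain ⟨e⟩ : Nonempty (Fin c ≃ κ) := ⟨(Fintype.equivFinOfCardEq hcard).symm⟩
  refine ⟨a ∘ e, ?_⟩
  have hli' : LinearIndependent L (M.submatrix id (a ∘ e)).col := by
    have : (M.submatrix id (a ∘ e)).col = (M.col ∘ a) ∘ e := by
      funext j
      rfl
    rw [this]
    exact hli.comp e e.injective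
  have hunit : IsUnit (M.submatrix id (a ∘ e)) := Matrix.linearIndependent_cols_iff_isUnit.mp hli'
  exact ((Matrix.isUnit_iff_isUnit_det _).mp hunit).ne_zero

/-! ### The stub -/

/-- **Reduction data at a place of `ℂ` above `p` in a Gauss–lattice basis.**  Every complex representation
`Σ_{i<s} c_i g_i² = F_p` yields a valuation subring `V ⊂ ℂ` with `p ∈ 𝔪_V`, `r ≤ s` polynomials
`w_j ∈ V[X]` supported on `⋃ supp g_i` whose reductions are linearly independent over the residue field, and
`T ∈ M_r(V)`, `μ ∈ V ∖ {0}` with `Σ_{j,j'} T_{jj'} w_j w_{j'} = μ·F_p` in `V[X]`, normalised so that `μ = 1` or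
some `T_{jj'} = 1`. [folklore] -/
theorem stub_placeReduction :
    ∀ (p : ℕ) [Fact p.Prime] (s : ℕ) (c : Fin s → ℂ) (g : Fin s → ℂ[X]),
      (∑ i, C (c i) * g i ^ 2) = (feketePolynomial p).map (Int.castRingHom ℂ) →
      ∃ (V : ValuationSubring ℂ) (r : ℕ) (w : Fin r → V[X]) (T : Matrix (Fin r) (Fin r) V) (μ : V),
        ((p : ℕ) : V) ∈ IsLocalRing.maximalIdeal V ∧ r ≤ s ∧ μ ≠ 0 ∧ (μ = 1 ∨ ∃ j j', T j j' = 1) ∧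
        LinearIndependent (IsLocalRing.ResidueField V)
          (fun j => (w j).map (IsLocalRing.residue V)) ∧
        (∀ j, ((w j).map (algebraMap V ℂ)).support ⊆ Finset.univ.biUnion fun i => (g i).support) ∧
        (∑ j, ∑ j', C (T j j') * (w j * w j')) = C μ * (feketePolynomial p).map (Int.castRingHom V) := by
  intro p _ s c g hrep
  classical
  have hprime : p.Prime := Fact.out
  -- Step 0: a place of `ℂ` above `p`
  obtain ⟨V, hpV⟩ := exists_valuationSubring_natCast_mem_maximalIdeal (K := ℂ) hprime
  have hιinj : Function.Injective (algebraMap V ℂ) := IsFractionRing.injective V ℂ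
  have hιapp : ∀ x : V, algebraMap V ℂ x = x := fun x => rfl
  -- Step 1: the exponent set `U` and the coefficient rows `γ i : U → ℂ`
  set U : Finset ℕ := Finset.univ.biUnion fun i => (g i).support with hU
  have hgU : ∀ i, (g i).support ⊆ U := fun i =>
    Finset.subset_biUnion_of_mem (fun i => (g i).support) (Finset.mem_univ i)
  obtain ⟨γ, hγ⟩ : ∃ γ : Fin s → U → ℂ, ∀ i u, γ i u = (g i).coeff u := ⟨_, fun _ _ => rfl⟩
  have hgγ : ∀ i, g i = ∑ u : U, C (γ i u) * X ^ (u : ℕ) := fun i => by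
    simp_rw [hγ]
    exact pr2_eq_sum_of_support_subset U (hgU i)
  -- Step 2: a basis `M` of the row space `W`
  set W : Submodule ℂ (U → ℂ) := Submodule.span ℂ (Set.range γ) with hW
  obtain ⟨r, hr⟩ : ∃ r : ℕ, Module.finrank ℂ W = r := ⟨_, rfl⟩
  have hrs : r ≤ s := by
    have h : Module.finrank ℂ W ≤ Fintype.card (Fin s) := finrank_range_le_card (R := ℂ) γ
    rwa [hr, Fintype.card_fin] at h
  set B : Module.Basis (Fin r) ℂ W := Module.finBasisOfFinrankEq ℂ W hr with hB
  obtain ⟨M, hM⟩ : ∃ M : Matrix (Fin r) U ℂ, ∀ k, M k = (B k : U → ℂ) := ⟨fun k => (B k : U → ℂ), fun _ => rfl⟩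
  have hMli : LinearIndependent ℂ M.row := by
    have h1 : M.row = (W.subtype : W → (U → ℂ)) ∘ B := by
      funext k
      rw [Matrix.row, hM k]
      rfl
    rw [h1]
    exact B.linearIndependent.map' W.subtype (Submodule.ker_subtype W)
  have hγM : ∀ i, ∃ b : Fin r → ℂ, γ i = ∑ k, b k • M k := by
    intro i
    have hmem : γ i ∈ W := Submodule.subset_span ⟨i, rfl⟩
    refine ⟨fun k => B.repr ⟨γ i, hmem⟩ k, ?_⟩
    have h := congrArg Subtype.val (B.sum_repr ⟨γ i, hmem⟩)
    rw [Submodule.coe_sum] at h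
    simp only [Submodule.coe_smul] at h
    simp_rw [hM]
    exact h.symm
  -- Step 3: a maximal minor
  obtain ⟨σ₀, hσ₀⟩ := pr2_exists_submatrix_det_ne_zero M hMli
  set v := V.valuation with hv
  obtain ⟨σ, -, hσmax⟩ := Finset.exists_max_image (Finset.univ : Finset (Fin r → U))
    (fun τ => v (M.submatrix id τ).det) ⟨σ₀, Finset.mem_univ _⟩
  set P : Matrix (Fin r) (Fin r) ℂ := M.submatrix id σ with hP
  have hPdet : P.det ≠ 0 := by
    intro h0
    have h1 : v (M.submatrix id σ₀).det ≤ v P.det := hσmax σ₀ (Finset.mem_univ _)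
    rw [h0, map_zero, le_zero_iff, map_eq_zero] at h1
    exact hσ₀ h1
  have hPunit : IsUnit P.det := isUnit_iff_ne_zero.mpr hPdet
  have hvP : v P.det ≠ 0 := (map_ne_zero v).mpr hPdet
  set N : Matrix (Fin r) U ℂ := P⁻¹ * M with hN
  have hPN : P * N = M := Matrix.mul_nonsing_inv_cancel_left P M hPunit
  have hNσ : ∀ j k, N j (σ k) = if j = k then 1 else 0 := by
    intro j k
    have h1 : (P⁻¹ * P) j k = if j = k then 1 else 0 := by
      rw [Matrix.nonsing_inv_mul P hPunit, Matrix.one_apply]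
    rw [Matrix.mul_apply] at h1
    rw [hN, Matrix.mul_apply]
    exact h1
  -- entries of `N` times `det P` are minors of `M`
  have hNdet : ∀ j u, N j u * P.det = (M.submatrix id (Function.update σ j u)).det := by
    intro j u
    have h1 : P.det • N = P.adjugate * M := by
      rw [hN, ← Matrix.smul_mul, Matrix.inv_def, smul_smul, Ring.inverse_eq_inv,
        mul_inv_cancel₀ hPdet, one_smul]
    have h2 := congrFun (congrFun h1 j) u
    rw [Matrix.smul_apply, smul_eq_mul] at h2
    rw [mul_comm, h2, Matrix.mul_apply]
    have h4 : Matrix.mulVec P.adjugate (fun i => M i u) j = ∑ i, P.adjugate j i * M i u := rfl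
    rw [← h4, ← Matrix.cramer_eq_adjugate_mulVec, Matrix.cramer_apply]
    congr 1
    ext i k
    rw [Matrix.updateCol_apply, Matrix.submatrix_apply, Function.update_apply]
    split_ifs
    · rfl
    · rfl
  have hNV : ∀ j u, N j u ∈ V := by
    intro j u
    rw [← V.valuation_le_one_iff]
    have h1 : v (M.submatrix id (Function.update σ j u)).det ≤ v P.det :=
      hσmax (Function.update σ j u) (Finset.mem_univ _)
    rw [← hNdet j u, map_mul] at h1
    calc V.valuation (N j u) = v (N j u) * v P.det * (v P.det)⁻¹ := by
          rw [mul_assoc, mul_inv_cancel₀ hvP, mul_one]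
      _ ≤ v P.det * (v P.det)⁻¹ := mul_le_mul' h1 le_rfl
      _ = 1 := mul_inv_cancel₀ hvP
  -- Step 4: the lattice basis `w j = Σ_u N_{ju} X^u ∈ V[X]`
  obtain ⟨Nv, hNv⟩ : ∃ Nv : Fin r → U → V, ∀ j u, (Nv j u : ℂ) = N j u :=
    ⟨fun j u => ⟨N j u, hNV j u⟩, fun _ _ => rfl⟩
  obtain ⟨w, hw⟩ : ∃ w : Fin r → V[X], ∀ j, w j = ∑ u : U, C (Nv j u) * X ^ (u : ℕ) :=
    ⟨_, fun _ => rfl⟩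
  have hwι : ∀ j, (w j).map (algebraMap V ℂ) = ∑ u : U, C (N j u) * X ^ (u : ℕ) := by
    intro j
    rw [hw j, pr2_map_sum]
    simp_rw [hιapp, hNv]
  have hwsupp : ∀ j, ((w j).map (algebraMap V ℂ)).support ⊆ U := fun j => by
    rw [hwι]
    exact pr2_support_sum_subset U _
  have hwli : LinearIndependent (ResidueField V) fun j => (w j).map (residue V) := by
    have h1 : ∀ j, (w j).map (residue V) = ∑ u : U, C (residue V (Nv j u)) * X ^ (u : ℕ) :=
      fun j => by rw [hw j, pr2_map_sum]
    simp_rw [h1]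
    refine pr2_linearIndependent_emb U (v := fun j u => residue V (Nv j u)) ?_
    refine pr2_linearIndependent_of_submatrix_one σ fun j k => ?_
    have h2 : Nv j (σ k) = if j = k then 1 else 0 := by
      apply Subtype.ext
      rw [hNv, hNσ]
      split_ifs
      · rfl
      · rfl
    show residue V (Nv j (σ k)) = _
    rw [h2]
    split_ifs
    · exact map_one _
    · exact map_zero _
  -- Step 5: the change of basis `g i = Σ_j A i j • w j` over `ℂ`
  have hA : ∀ i, ∃ A : Fin r → ℂ, g i = ∑ j, C (A j) * (w j).map (algebraMap V ℂ) := by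
    intro i
    obtain ⟨b, hb⟩ := hγM i
    refine ⟨Matrix.vecMul b P, ?_⟩
    have h1 : γ i = ∑ j, (Matrix.vecMul b P) j • N j := by
      rw [hb]
      funext u
      simp only [Finset.sum_apply, Pi.smul_apply, smul_eq_mul, Matrix.vecMul, dotProduct]
      rw [← hPN]
      simp only [Matrix.mul_apply, Finset.mul_sum, Finset.sum_mul]
      rw [Finset.sum_comm]
      exact Finset.sum_congr rfl fun _ _ => Finset.sum_congr rfl fun _ _ => by ring
    rw [hgγ i, h1, pr2_sum_smul_emb]
    simp_rw [hwι]
  choose A hA using hA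
  -- Step 6: the Gram matrix `T₀ = Aᵀ diag(c) A`
  obtain ⟨T₀, hT₀def⟩ : ∃ T₀ : Fin r → Fin r → ℂ, ∀ j j', T₀ j j' = ∑ i, c i * A i j * A i j' :=
    ⟨_, fun _ _ => rfl⟩
  have hT₀ : (∑ j, ∑ j', C (T₀ j j') * ((w j).map (algebraMap V ℂ) * (w j').map (algebraMap V ℂ))) =
      (feketePolynomial p).map (Int.castRingHom ℂ) := by
    rw [← hrep]
    have h1 : ∀ i, C (c i) * g i ^ 2 = ∑ j, ∑ j', C (c i * A i j * A i j') *
        ((w j).map (algebraMap V ℂ) * (w j').map (algebraMap V ℂ)) := by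
      intro i
      rw [hA i, pow_two, Finset.sum_mul_sum, Finset.mul_sum]
      refine Finset.sum_congr rfl fun j _ => ?_
      rw [Finset.mul_sum]
      refine Finset.sum_congr rfl fun j' _ => ?_
      simp only [map_mul]
      ring
    symm
    calc (∑ i, C (c i) * g i ^ 2)
        = ∑ i, ∑ j, ∑ j', C (c i * A i j * A i j') *
            ((w j).map (algebraMap V ℂ) * (w j').map (algebraMap V ℂ)) :=
          Finset.sum_congr rfl fun i _ => h1 i
      _ = ∑ j, ∑ i, ∑ j', C (c i * A i j * A i j') *
            ((w j).map (algebraMap V ℂ) * (w j').map (algebraMap V ℂ)) := Finset.sum_comm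
      _ = ∑ j, ∑ j', ∑ i, C (c i * A i j * A i j') *
            ((w j).map (algebraMap V ℂ) * (w j').map (algebraMap V ℂ)) :=
          Finset.sum_congr rfl fun j _ => Finset.sum_comm
      _ = ∑ j, ∑ j', C (T₀ j j') * ((w j).map (algebraMap V ℂ) * (w j').map (algebraMap V ℂ)) := by
          refine Finset.sum_congr rfl fun j _ => Finset.sum_congr rfl fun j' _ => ?_
          rw [hT₀def, map_sum, Finset.sum_mul]
  -- Step 7: normalisation
  have hnorm : ∃ μc : ℂ, μc ≠ 0 ∧ μc ∈ V ∧ (∀ j j', μc * T₀ j j' ∈ V) ∧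
      (μc = 1 ∨ ∃ j j', μc * T₀ j j' = 1) := by
    by_cases hall : ∀ j j', T₀ j j' ∈ V
    · exact ⟨1, one_ne_zero, V.one_mem, fun j j' => by rw [one_mul]; exact hall j j', Or.inl rfl⟩
    · push Not at hall
      obtain ⟨j₁, j₁', hj₁⟩ := hall
      obtain ⟨jj₀, -, hmax⟩ := Finset.exists_max_image (Finset.univ : Finset (Fin r × Fin r))
        (fun jj => v (T₀ jj.1 jj.2)) ⟨(j₁, j₁'), Finset.mem_univ _⟩
      set t : ℂ := T₀ jj₀.1 jj₀.2 with ht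
      have htV : t ∉ V := by
        intro htV
        apply hj₁
        rw [← V.valuation_le_one_iff] at htV ⊢
        have h1 : v (T₀ j₁ j₁') ≤ v t := hmax (j₁, j₁') (Finset.mem_univ _)
        exact h1.trans htV
      have ht0 : t ≠ 0 := fun h => htV (h ▸ V.zero_mem)
      have htinv : t⁻¹ ∈ V := (V.mem_or_inv_mem t).resolve_left htV
      have hvt : v t ≠ 0 := (map_ne_zero v).mpr ht0
      refine ⟨t⁻¹, inv_ne_zero ht0, htinv, fun j j' => ?_, Or.inr ⟨jj₀.1, jj₀.2, inv_mul_cancel₀ ht0⟩⟩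
      rw [← V.valuation_le_one_iff, map_mul, map_inv₀]
      have h1 : v (T₀ j j') ≤ v t := hmax (j, j') (Finset.mem_univ _)
      calc (V.valuation t)⁻¹ * V.valuation (T₀ j j') ≤ (v t)⁻¹ * v t := mul_le_mul' le_rfl h1
        _ = 1 := inv_mul_cancel₀ hvt
  obtain ⟨μc, hμ0, hμV, hTV, hdisj⟩ := hnorm
  -- Step 8: assemble
  refine ⟨V, r, w, fun j j' => ⟨μc * T₀ j j', hTV j j'⟩, ⟨μc, hμV⟩, hpV, hrs, ?_, ?_, hwli, hwsupp, ?_⟩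
  · intro h
    exact hμ0 (congrArg Subtype.val h)
  · rcases hdisj with h | ⟨j, j', h⟩
    · exact Or.inl (Subtype.ext h)
    · exact Or.inr ⟨j, j', Subtype.ext h⟩
  · apply Polynomial.map_injective (algebraMap V ℂ) hιinj
    -- `F_p` over `V`, pushed to `ℂ`, is `F_p` over `ℂ`
    have hF : ((feketePolynomial p).map (Int.castRingHom V)).map (algebraMap V ℂ) =
        (feketePolynomial p).map (Int.castRingHom ℂ) := by
      rw [Polynomial.map_map, RingHom.ext_int ((algebraMap V ℂ).comp (Int.castRingHom V)) (Int.castRingHom ℂ)]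
    rw [Polynomial.map_mul, map_C, hιapp, hF, ← hT₀, Finset.mul_sum, Polynomial.map_sum]
    refine Finset.sum_congr rfl fun j _ => ?_
    rw [Finset.mul_sum, Polynomial.map_sum]
    refine Finset.sum_congr rfl fun j' _ => ?_
    rw [Polynomial.map_mul, Polynomial.map_mul, map_C, hιapp, map_mul]
    show (C μc * C (T₀ j j')) * _ = C μc * _
    ring
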